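import Summits.Ventures.PercRepro.RankLevelSetMinorPairSkewSum
import Summits.Ventures.PercRepro.RankLevelSetBiIndepContainSkewTruncate
import Summits.Ventures.PercRepro.RankLevelSetBiIndepLRModel

/-! # RankLevelSetMinorPairSkewTruncate — THE CUMULATIVE CONTAIN-SET SKEWS ARE CLOSED UNDER TRUNCATION; THE MODEL
FAMILY SATISFIES THE HALF RULE ON EVERY CONTAIN-SET, HENCE (CX*) WITH EVERY CONTAIN-SET (night-1 g30; dossier §42)

The truncation `T_k M` (g24's `truncateTo M k`) windows every contain profile to the levels `#E − k ≤ level ≤ k`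
(`biContainCount_truncateTo`, g28), a window symmetric about `#E/2`. A cumulative skew `MinorPairSkew M X ∅ R` with
`R ≤ #E − 2#X` (the half rule `R = #E − 2#X`, the cumulative (CX*) `R = #E − 2#X − 1`) survives the windowing: for a
comparison `i < j`, `i + j ≤ R` with `j` cut off above, `i` is cut off below (**`minorPairSkew_contain_truncateTo`**).
COROLLARIES for the cell's model family `T_p(U_{q,F} ⊕ U_{D,D}) = modelMatroid hE F q p` (g26:
`modelMatroid_eq_truncateTo_disjointSum`): the two uniform summands satisfy the half rule on every contain-set
(`minorPairSkew_half_uniform`), the half rule is ⊕-closed (`minorPairSkew_half_disjointSum`) and truncation-closed, so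
**`minorPairSkew_half_modelMatroid`**: the whole model family satisfies the half rule on every contain-set, and
**`biContainSkew_modelMatroid`**: (CX*) holds on every model matroid with EVERY contain-set (g28 had it only for
contain-sets inside one part, through the one-sided sum). Nothing here asserts (CX*); every declaration has a
docstring; imports: the cell's own modules and Mathlib only. Axioms: standard. -/

namespace PercRepro

open Set Matroid

variable {α : Type} (M : Matroid α) [M.Finite]

/-- The mixed profile of `(X, ∅)` in the truncation `T_k M` is the window `#E − (i + #X) ≤ k` of that of `M`
(in the shifted index `i = level − #X`). -/
lemma minorPairCount_truncateTo {X : Set α} (hX : X ⊆ M.E) (k i : ℕ) :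
    haveI := truncateTo_finite M k
    minorPairCount (truncateTo M k) X ∅ i =
      if i + X.ncard ≤ k ∧ M.E.ncard - (i + X.ncard) ≤ k then minorPairCount M X ∅ i else 0 := by
  haveI := truncateTo_finite M k
  have h1 := biContainCount_eq_minorPairCount (truncateTo M k) (X := X) (by rw [truncateTo_E]; exact hX)
    (k := i + X.ncard) (by omega)
  have h2 := biContainCount_eq_minorPairCount M hX (k := i + X.ncard) (by omega)
  rw [Nat.add_sub_cancel] at h1 h2
  rw [← h1, biContainCount_truncateTo M X k (i + X.ncard), h2]

/-- **THE CUMULATIVE CONTAIN-SET SKEWS ARE CLOSED UNDER TRUNCATION** (for parameters `R ≤ #E − 2#X`: the half rule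
and the cumulative (CX*)). -/
theorem minorPairSkew_contain_truncateTo {X : Set α} (hX : X ⊆ M.E) {R : ℕ} (hR : R ≤ M.E.ncard - 2 * X.ncard)
    (h : MinorPairSkew M X ∅ R) (k : ℕ) :
    haveI := truncateTo_finite M k
    MinorPairSkew (truncateTo M k) X ∅ R := by
  haveI := truncateTo_finite M k
  intro i j hij hR'
  rw [minorPairCount_truncateTo M hX k i, minorPairCount_truncateTo M hX k j]
  split_ifs with hi hj hj
  · exact h i j hij hR'
  · exfalso
    omega
  · exact Nat.zero_le _
  · exact le_rfl

/-- **THE MODEL FAMILY SATISFIES THE HALF RULE ON EVERY CONTAIN-SET**: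
`MinorPairSkew (modelMatroid hE F q p) X ∅ (#E − 2#X)` for every `X ⊆ E`. -/
theorem minorPairSkew_half_modelMatroid {E : Set α} (hE : E.Finite) {F : Set α} (hF : F ⊆ E) (q p : ℕ) :
    haveI := modelMatroid_finite hE F q p
    ∀ X ⊆ E, MinorPairSkew (modelMatroid hE F q p) X ∅ (E.ncard - 2 * X.ncard) := by
  haveI := modelMatroid_finite hE F q p
  haveI := modelMatroid_finite (hE.subset hF) ∅ q q
  haveI := modelMatroid_finite ((hE.subset (Set.sdiff_subset : E \ F ⊆ E))) ∅ (E \ F).ncard (E \ F).ncard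
  set N := (modelMatroid (hE.subset hF) ∅ q q).disjointSum
    (modelMatroid ((hE.subset (Set.sdiff_subset : E \ F ⊆ E))) ∅ (E \ F).ncard (E \ F).ncard)
    Set.disjoint_sdiff_right with hN
  haveI : N.Finite := ⟨by
    rw [hN, Matroid.disjointSum_ground_eq, modelMatroid_E, modelMatroid_E]
    exact (hE.subset hF).union ((hE.subset (Set.sdiff_subset : E \ F ⊆ E)))⟩
  have hNE : N.E = E := by
    rw [hN, Matroid.disjointSum_ground_eq, modelMatroid_E, modelMatroid_E, Set.union_sdiff_cancel hF]
  have hhalf : ∀ X ⊆ N.E, MinorPairSkew N X ∅ (N.E.ncard - 2 * X.ncard) :=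
    minorPairSkew_half_disjointSum (fun Y hY => minorPairSkew_half_uniform (hE.subset hF) q q hY)
      (fun Y hY => minorPairSkew_half_uniform (hE.subset (Set.sdiff_subset : E \ F ⊆ E)) _ _ hY)
  intro X hX
  have heq := modelMatroid_eq_truncateTo_disjointSum hE hF q p
  rw [heq]
  have := minorPairSkew_contain_truncateTo N (X := X) (by rw [hNE]; exact hX) (R := N.E.ncard - 2 * X.ncard) le_rfl
    (hhalf X (by rw [hNE]; exact hX)) p
  rwa [hNE] at this

/-- **(CX*) ON THE WHOLE MODEL FAMILY WITH EVERY CONTAIN-SET**: `BiContainSkew (modelMatroid hE F q p)`. -/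
theorem biContainSkew_modelMatroid {E : Set α} (hE : E.Finite) {F : Set α} (hF : F ⊆ E) (q p : ℕ) :
    haveI := modelMatroid_finite hE F q p
    BiContainSkew (modelMatroid hE F q p) := by
  haveI := modelMatroid_finite hE F q p
  refine biContainSkew_of_minorPairSkew _ fun X hX => ?_
  rw [modelMatroid_E] at hX
  have := minorPairSkew_half_modelMatroid hE hF q p X hX
  exact minorPairSkew_mono _ (by rw [modelMatroid_E]; exact this) (Nat.sub_le _ _)

end PercRepro
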